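import Mathlib
import HarnessLib
import Summits.NavierStokesRegularity.NavierStokesRegularity.Theorems.PoloidalWindowDoorPoloidalWindowRigidityThmAClass
import Summits.NavierStokesRegularity.NavierStokesRegularity.Theorems.PoloidalWindowDoorPoloidalWindowRigidityK2OfLrcSlope
import Summits.NavierStokesRegularity.NavierStokesRegularity.Theorems.IsobarTomographyTubeAlternativeStubDefectAnalyticOfVelocity

/-!
# Theorem A, relocation: on (TH), the TWISTING stub reduces to its HYPERBOLIC part

Seat ns-poloidal-K2-p2 g6 (interim lead-of-record on crux K2 `PoloidalWindowRigidity` = stmt-NavierStokesRegularity-19708;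
line `mixed_type` v1; item stmt-20428 `LrcModEntire`).  Consequence of the class form of Theorem A
(`…ThmAClass.exists_hyperbolic_point_of_TH`: every slice through a class (TH) window carries a point of negative type scalar)
combined with the RELOCATION argument of the `mixed_type` skeleton (cstrat-19708, `Cruxes/PoloidalWindowRigidity/Lines/mixed_type.lean`,
`twisting_of_mixedType`, adapted here to the kernel):

* `twistingTH_regular_of_hyperbolicTH` — for a profile `v` of the route's class (Type-I, continuous, Oseen-mild, div-free,
  poloidal): IF every nonempty open NON-DEGENERATE + PINNED + TWISTING + **HYPERBOLIC** + (TH) window forces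
  `¬ IsBackwardSingularPoint v 0` (= the `mixed_type` v1 stub `stub_hyperbolicTH` for this `v`; = K2-p3's
  `stub_hyperbolicTH_of_localEmpty hempty`), THEN every nonempty open non-degenerate + pinned + twisting + (TH) window does
  (= `lrc_jet` v5 `stub_twisting` ∩ (TH) = K2-p3's `twistingTH_regular_of_localEmpty` shape).

Proof: (TH) on `W` is GLOBAL (`…TimeHeightShearNormalForm.timeHeightShear_normalForm`: every plane of every slice is flat or
proportional-shear); the slice `s = z₀.1` through `z₀ ∈ W` has a hyperbolic point (Theorem A, class form); the open set
`W' = (J × ℝ³) ∩ {type < 0} ∩ {twist ≠ 0}` (`J` the time-side of a box of `W` around `z₀`) is nonempty (identity theorem for the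
analytic twist bracket on the slice), non-degenerate pointwise (`nd_of_typeScalar_neg`), inherits the pin (identity theorem for
`∂₂v_b − m(t)∂_bv₂` on slices meeting the box) and is (TH) (global normal form) — so the hyperbolic stub ends.
So after this file the (TH) column of crux 19708 / item 20428 is EXACTLY its hyperbolic part: `stub_twisting ∩ (TH)` ⇔ `stub_hyperbolicTH`.
WHAT THIS IS NOT: not a proof of K2 and not a claim about Navier–Stokes regularity (bears_on LADDER-NS N0 via crux 19708 / item 20428).
-/

-- the summit and its single sub-problem share the name (CONVENTIONS §1)
set_option linter.dupNamespace false

noncomputable section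

namespace Summit.NavierStokesRegularity.NavierStokesRegularity.Theorems.PoloidalWindowDoorPoloidalWindowRigidityThmARelocation

open Set Function Filter Topology Metric
open scoped RealInnerProductSpace InnerProductSpace
open Literature.Analysis Literature.Analysis.FluidPDE
open Summit.NavierStokesRegularity.NavierStokesRegularity.Theorems.PoloidalWindowDoorPoloidalWindowRigidityThmAClass
open Summit.NavierStokesRegularity.NavierStokesRegularity.Theorems.PoloidalWindowDoorPoloidalWindowRigidityTimeHeightShearNormalForm
open Summit.NavierStokesRegularity.NavierStokesRegularity.Theorems.PoloidalWindowDoorPoloidalWindowRigidityK2OfLrcSlope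
open Summit.NavierStokesRegularity.NavierStokesRegularity.Theorems.TubeAlternative.AnalyticPropagation

/-! ### Pointwise: a hyperbolic point is non-degenerate (cstrat's `nd_of_inner_neg`, adapted) -/

/-- At a point where `∂₂v₀·∂₀v₂ + ∂₂v₁·∂₁v₂ < 0` the field is non-degenerate: `curl V ≠ 0`, `∇ₕv₂ ≠ 0`, `∂₂vₕ ≠ 0`.
(Adapted from `Cruxes/PoloidalWindowRigidity/Lines/mixed_type.lean`, `nd_of_inner_neg`.) -/
theorem nd_of_typeScalar_neg (V : EuclideanSpace ℝ (Fin 3) → EuclideanSpace ℝ (Fin 3)) (x : EuclideanSpace ℝ (Fin 3))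
    (h : fderiv ℝ V x (EuclideanSpace.single 2 1) 0 * fderiv ℝ V x (EuclideanSpace.single 0 1) 2 +
      fderiv ℝ V x (EuclideanSpace.single 2 1) 1 * fderiv ℝ V x (EuclideanSpace.single 1 1) 2 < 0) :
    Literature.Analysis.FluidPDE.curl V x ≠ 0 ∧
      (fderiv ℝ V x (EuclideanSpace.single 0 1) 2 ≠ 0 ∨ fderiv ℝ V x (EuclideanSpace.single 1 1) 2 ≠ 0) ∧
      (fderiv ℝ V x (EuclideanSpace.single 2 1) 0 ≠ 0 ∨ fderiv ℝ V x (EuclideanSpace.single 2 1) 1 ≠ 0) := by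
  refine ⟨?_, ?_, ?_⟩
  · intro hc
    have h0 : curl V x 0 = 0 := by rw [hc]; simp
    have h1 : curl V x 1 = 0 := by rw [hc]; simp
    rw [curl_apply_zero_eq] at h0
    rw [curl_apply_one_eq] at h1
    have e1 : fderiv ℝ V x (EuclideanSpace.single 2 1) 1 = fderiv ℝ V x (EuclideanSpace.single 1 1) 2 := by linarith
    have e0 : fderiv ℝ V x (EuclideanSpace.single 2 1) 0 = fderiv ℝ V x (EuclideanSpace.single 0 1) 2 := by linarith
    rw [e0, e1] at h
    nlinarith [sq_nonneg (fderiv ℝ V x (EuclideanSpace.single 0 1) 2), sq_nonneg (fderiv ℝ V x (EuclideanSpace.single 1 1) 2)]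
  · by_contra hc
    push Not at hc
    rw [hc.1, hc.2] at h
    simp at h
  · by_contra hc
    push Not at hc
    rw [hc.1, hc.2] at h
    simp at h

/-! ### Analytic toolkit (cstrat's, adapted): slices of the Jacobian entries, the twist, the type scalar -/

section Toolkit

variable {C : ℝ} {v : ℝ → EuclideanSpace ℝ (Fin 3) → EuclideanSpace ℝ (Fin 3)}

/-- Per slice `s < 0`, the Jacobian entry `y ↦ D(v s)(y)[e_j]_i` is real-analytic on `ℝ³`. -/
theorem entry_analyticOnNhd_slice (hrate : HasTypeITimeDecay C v)
    (hcont : ContinuousOn (uncurry v) (Iio (0 : ℝ) ×ˢ univ))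
    (hmild : ∀ s t : ℝ, s < t → t < 0 → ∀ x,
      v t x = UnboundedOperators.heatExtension (v s) (t - s) x - oseenDuhamel 1 s v v t x)
    (j i : Fin 3) {s : ℝ} (hs : s < 0) :
    AnalyticOnNhd ℝ (fun y => fderiv ℝ (v s) y (EuclideanSpace.single j 1) i) univ :=
  fun y _ => analyticAt_slice_of_analyticOnNhd_uncurry
    (w := fun s y => fderiv ℝ (v s) y (EuclideanSpace.single j 1) i)
    (analyticOnNhd_uncurry_fderiv_entry hrate hcont hmild j i) hs y

/-- The horizontal derivatives `(s,y) ↦ ∂_b(∂₂v₂)(s,y)` are jointly real-analytic on the slab. -/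
theorem entry2_analyticOnNhd_uncurry (hrate : HasTypeITimeDecay C v)
    (hcont : ContinuousOn (uncurry v) (Iio (0 : ℝ) ×ˢ univ))
    (hmild : ∀ s t : ℝ, s < t → t < 0 → ∀ x,
      v t x = UnboundedOperators.heatExtension (v s) (t - s) x - oseenDuhamel 1 s v v t x) (b : Fin 3) :
    AnalyticOnNhd ℝ (uncurry fun s y =>
      fderiv ℝ (fun x => fderiv ℝ (v s) x (EuclideanSpace.single 2 1) 2) y (EuclideanSpace.single b 1))
      (Iio (0 : ℝ) ×ˢ univ) := by
  have h22 := analyticOnNhd_uncurry_fderiv_entry hrate hcont hmild 2 2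
  exact analyticOnNhd_uncurry_fderiv_slice_apply
    (w := fun s y => fderiv ℝ (v s) y (EuclideanSpace.single 2 1) 2) h22 isOpen_Iio
    (v := fun _ _ => EuclideanSpace.single b 1) analyticOnNhd_const

/-- Per slice `s < 0`, `y ↦ ∂_b(∂₂v₂)(s,y)` is real-analytic on `ℝ³`. -/
theorem entry2_analyticOnNhd_slice (hrate : HasTypeITimeDecay C v)
    (hcont : ContinuousOn (uncurry v) (Iio (0 : ℝ) ×ˢ univ))
    (hmild : ∀ s t : ℝ, s < t → t < 0 → ∀ x,
      v t x = UnboundedOperators.heatExtension (v s) (t - s) x - oseenDuhamel 1 s v v t x)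
    (b : Fin 3) {s : ℝ} (hs : s < 0) :
    AnalyticOnNhd ℝ (fun y =>
      fderiv ℝ (fun x => fderiv ℝ (v s) x (EuclideanSpace.single 2 1) 2) y (EuclideanSpace.single b 1)) univ :=
  fun y _ => analyticAt_slice_of_analyticOnNhd_uncurry
    (w := fun t x => fderiv ℝ (fun x' => fderiv ℝ (v t) x' (EuclideanSpace.single 2 1) 2) x (EuclideanSpace.single b 1))
    (entry2_analyticOnNhd_uncurry hrate hcont hmild b) hs y

/-- Per slice `s < 0`, the TWIST BRACKET is real-analytic on `ℝ³`. -/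
theorem twist_analyticOnNhd_slice (hrate : HasTypeITimeDecay C v)
    (hcont : ContinuousOn (uncurry v) (Iio (0 : ℝ) ×ˢ univ))
    (hmild : ∀ s t : ℝ, s < t → t < 0 → ∀ x,
      v t x = UnboundedOperators.heatExtension (v s) (t - s) x - oseenDuhamel 1 s v v t x)
    {s : ℝ} (hs : s < 0) :
    AnalyticOnNhd ℝ (fun y =>
      fderiv ℝ (fun x => fderiv ℝ (v s) x (EuclideanSpace.single 2 1) 2) y (EuclideanSpace.single 0 1) *
          fderiv ℝ (v s) y (EuclideanSpace.single 1 1) 2 -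
        fderiv ℝ (fun x => fderiv ℝ (v s) x (EuclideanSpace.single 2 1) 2) y (EuclideanSpace.single 1 1) *
          fderiv ℝ (v s) y (EuclideanSpace.single 0 1) 2) univ :=
  fun y hy =>
    (((entry2_analyticOnNhd_slice hrate hcont hmild 0 hs) y hy).fun_mul
        ((entry_analyticOnNhd_slice hrate hcont hmild 1 2 hs) y hy)).fun_sub
      (((entry2_analyticOnNhd_slice hrate hcont hmild 1 hs) y hy).fun_mul
        ((entry_analyticOnNhd_slice hrate hcont hmild 0 2 hs) y hy))

/-- Per slice `s < 0`, the TYPE SCALAR `y ↦ ∂₂v₀·∂₀v₂ + ∂₂v₁·∂₁v₂` is real-analytic on `ℝ³`. -/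
theorem typeScalar_analyticOnNhd_slice (hrate : HasTypeITimeDecay C v)
    (hcont : ContinuousOn (uncurry v) (Iio (0 : ℝ) ×ˢ univ))
    (hmild : ∀ s t : ℝ, s < t → t < 0 → ∀ x,
      v t x = UnboundedOperators.heatExtension (v s) (t - s) x - oseenDuhamel 1 s v v t x)
    {s : ℝ} (hs : s < 0) :
    AnalyticOnNhd ℝ (fun y =>
      fderiv ℝ (v s) y (EuclideanSpace.single 2 1) 0 * fderiv ℝ (v s) y (EuclideanSpace.single 0 1) 2 +
        fderiv ℝ (v s) y (EuclideanSpace.single 2 1) 1 * fderiv ℝ (v s) y (EuclideanSpace.single 1 1) 2) univ :=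
  fun y hy =>
    (((entry_analyticOnNhd_slice hrate hcont hmild 2 0 hs) y hy).fun_mul
        ((entry_analyticOnNhd_slice hrate hcont hmild 0 2 hs) y hy)).fun_add
      (((entry_analyticOnNhd_slice hrate hcont hmild 2 1 hs) y hy).fun_mul
        ((entry_analyticOnNhd_slice hrate hcont hmild 1 2 hs) y hy))

/-- Per slice `s < 0` and any real `μ`, `y ↦ ∂₂v_b − μ ∂_bv₂` is real-analytic on `ℝ³`. -/
theorem shearDefect_analyticOnNhd_slice (hrate : HasTypeITimeDecay C v)
    (hcont : ContinuousOn (uncurry v) (Iio (0 : ℝ) ×ˢ univ))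
    (hmild : ∀ s t : ℝ, s < t → t < 0 → ∀ x,
      v t x = UnboundedOperators.heatExtension (v s) (t - s) x - oseenDuhamel 1 s v v t x)
    (μ : ℝ) (b : Fin 3) {s : ℝ} (hs : s < 0) :
    AnalyticOnNhd ℝ (fun y =>
      fderiv ℝ (v s) y (EuclideanSpace.single 2 1) b - μ * fderiv ℝ (v s) y (EuclideanSpace.single b 1) 2) univ :=
  fun y hy =>
    ((entry_analyticOnNhd_slice hrate hcont hmild 2 b hs) y hy).fun_sub
      (analyticAt_const.fun_mul ((entry_analyticOnNhd_slice hrate hcont hmild b 2 hs) y hy))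

/-- The twist bracket is jointly continuous on the slab. -/
theorem continuousOn_twist (hrate : HasTypeITimeDecay C v)
    (hcont : ContinuousOn (uncurry v) (Iio (0 : ℝ) ×ˢ univ))
    (hmild : ∀ s t : ℝ, s < t → t < 0 → ∀ x,
      v t x = UnboundedOperators.heatExtension (v s) (t - s) x - oseenDuhamel 1 s v v t x) :
    ContinuousOn (fun z : ℝ × EuclideanSpace ℝ (Fin 3) =>
      fderiv ℝ (fun x => fderiv ℝ (v z.1) x (EuclideanSpace.single 2 1) 2) z.2 (EuclideanSpace.single 0 1) *
          fderiv ℝ (v z.1) z.2 (EuclideanSpace.single 1 1) 2 -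
        fderiv ℝ (fun x => fderiv ℝ (v z.1) x (EuclideanSpace.single 2 1) 2) z.2 (EuclideanSpace.single 1 1) *
          fderiv ℝ (v z.1) z.2 (EuclideanSpace.single 0 1) 2) (Iio (0 : ℝ) ×ˢ univ) := by
  have hD : ∀ j i : Fin 3, ContinuousOn
      (fun z : ℝ × EuclideanSpace ℝ (Fin 3) => fderiv ℝ (v z.1) z.2 (EuclideanSpace.single j 1) i)
      (Iio (0 : ℝ) ×ˢ univ) := fun j i => continuousOn_fderiv_entry hrate hcont hmild j i
  have hD2 : ∀ b : Fin 3, ContinuousOn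
      (fun z : ℝ × EuclideanSpace ℝ (Fin 3) =>
        fderiv ℝ (fun x => fderiv ℝ (v z.1) x (EuclideanSpace.single 2 1) 2) z.2 (EuclideanSpace.single b 1))
      (Iio (0 : ℝ) ×ˢ univ) := fun b => (entry2_analyticOnNhd_uncurry hrate hcont hmild b).continuousOn
  exact ((hD2 0).mul (hD 1 2)).sub ((hD2 1).mul (hD 0 2))

/-- The type scalar is jointly continuous on the slab. -/
theorem continuousOn_typeScalar (hrate : HasTypeITimeDecay C v)
    (hcont : ContinuousOn (uncurry v) (Iio (0 : ℝ) ×ˢ univ))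
    (hmild : ∀ s t : ℝ, s < t → t < 0 → ∀ x,
      v t x = UnboundedOperators.heatExtension (v s) (t - s) x - oseenDuhamel 1 s v v t x) :
    ContinuousOn (fun z : ℝ × EuclideanSpace ℝ (Fin 3) =>
      fderiv ℝ (v z.1) z.2 (EuclideanSpace.single 2 1) 0 * fderiv ℝ (v z.1) z.2 (EuclideanSpace.single 0 1) 2 +
        fderiv ℝ (v z.1) z.2 (EuclideanSpace.single 2 1) 1 * fderiv ℝ (v z.1) z.2 (EuclideanSpace.single 1 1) 2)
      (Iio (0 : ℝ) ×ˢ univ) := by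
  have hD : ∀ j i : Fin 3, ContinuousOn
      (fun z : ℝ × EuclideanSpace ℝ (Fin 3) => fderiv ℝ (v z.1) z.2 (EuclideanSpace.single j 1) i)
      (Iio (0 : ℝ) ×ˢ univ) := fun j i => continuousOn_fderiv_entry hrate hcont hmild j i
  exact ((hD 2 0).mul (hD 0 2)).add ((hD 2 1).mul (hD 1 2))

end Toolkit

/-! ### The relocation theorem -/

/-- **ON (TH), TWISTING ⇒ REGULAR reduces to HYPERBOLIC TWISTING ⇒ REGULAR.**  Class profile (Type-I, continuous, Oseen-mild,
div-free, poloidal).  Hypothesis `hH`: every nonempty open window in the slab that is non-degenerate, pinned, twisting,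
HYPERBOLIC and (TH) forces `¬ IsBackwardSingularPoint v 0` (the `mixed_type` stub `stub_hyperbolicTH` for this `v`).  Conclusion:
every nonempty open window in the slab that is non-degenerate, pinned, twisting and (TH) forces it (`lrc_jet` `stub_twisting` ∩ (TH)).
[folklore] -/
theorem twistingTH_regular_of_hyperbolicTH (C : ℝ) (v : ℝ → EuclideanSpace ℝ (Fin 3) → EuclideanSpace ℝ (Fin 3))
    (hrate : Literature.Analysis.FluidPDE.HasTypeITimeDecay C v)
    (hcont : ContinuousOn (Function.uncurry v) (Set.Iio (0 : ℝ) ×ˢ Set.univ))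
    (hmild : ∀ s t : ℝ, s < t → t < 0 → ∀ x, v t x =
      Literature.Analysis.UnboundedOperators.heatExtension (v s) (t - s) x -
        Literature.Analysis.FluidPDE.oseenDuhamel 1 s v v t x)
    (hdiv : ∀ t < 0, Literature.Analysis.FluidPDE.VectorCalculus.IsDivFree (v t))
    (hH : ∀ W' : Set (ℝ × EuclideanSpace ℝ (Fin 3)), IsOpen W' → W'.Nonempty → W' ⊆ Set.Iio (0 : ℝ) ×ˢ Set.univ →
      (∀ z ∈ W', Literature.Analysis.FluidPDE.curl (v z.1) z.2 ≠ 0 ∧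
        (fderiv ℝ (v z.1) z.2 (EuclideanSpace.single 0 1) 2 ≠ 0 ∨ fderiv ℝ (v z.1) z.2 (EuclideanSpace.single 1 1) 2 ≠ 0) ∧
        (fderiv ℝ (v z.1) z.2 (EuclideanSpace.single 2 1) 0 ≠ 0 ∨ fderiv ℝ (v z.1) z.2 (EuclideanSpace.single 2 1) 1 ≠ 0)) →
      (∀ m : ℝ → ℝ, ∀ W₁ : Set (ℝ × EuclideanSpace ℝ (Fin 3)), W₁ ⊆ W' → IsOpen W₁ → W₁.Nonempty →
        ∃ z ∈ W₁, ∃ b : Fin 3, b ≠ 2 ∧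
          fderiv ℝ (v z.1) z.2 (EuclideanSpace.single 2 1) b ≠
            m z.1 * fderiv ℝ (v z.1) z.2 (EuclideanSpace.single b 1) 2) →
      (∀ z ∈ W',
        fderiv ℝ (fun x => fderiv ℝ (v z.1) x (EuclideanSpace.single 2 1) 2) z.2 (EuclideanSpace.single 0 1) *
            fderiv ℝ (v z.1) z.2 (EuclideanSpace.single 1 1) 2 -
          fderiv ℝ (fun x => fderiv ℝ (v z.1) x (EuclideanSpace.single 2 1) 2) z.2 (EuclideanSpace.single 1 1) *
            fderiv ℝ (v z.1) z.2 (EuclideanSpace.single 0 1) 2 ≠ 0) →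
      (∀ z ∈ W',
        fderiv ℝ (v z.1) z.2 (EuclideanSpace.single 2 1) 0 * fderiv ℝ (v z.1) z.2 (EuclideanSpace.single 0 1) 2 +
          fderiv ℝ (v z.1) z.2 (EuclideanSpace.single 2 1) 1 * fderiv ℝ (v z.1) z.2 (EuclideanSpace.single 1 1) 2 < 0) →
      (∃ m : ℝ → ℝ → ℝ, ∀ z ∈ W', ∀ b : Fin 3, b ≠ 2 →
        fderiv ℝ (v z.1) z.2 (EuclideanSpace.single 2 1) b =
          m z.1 (z.2 2) * fderiv ℝ (v z.1) z.2 (EuclideanSpace.single b 1) 2) →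
      ¬ Literature.Analysis.FluidPDE.IsBackwardSingularPoint v 0)
    (W : Set (ℝ × EuclideanSpace ℝ (Fin 3))) (hW : IsOpen W) (hWne : W.Nonempty) (hWs : W ⊆ Set.Iio (0 : ℝ) ×ˢ Set.univ)
    (hnd : ∀ z ∈ W, Literature.Analysis.FluidPDE.curl (v z.1) z.2 ≠ 0 ∧
      (fderiv ℝ (v z.1) z.2 (EuclideanSpace.single 0 1) 2 ≠ 0 ∨ fderiv ℝ (v z.1) z.2 (EuclideanSpace.single 1 1) 2 ≠ 0) ∧
      (fderiv ℝ (v z.1) z.2 (EuclideanSpace.single 2 1) 0 ≠ 0 ∨ fderiv ℝ (v z.1) z.2 (EuclideanSpace.single 2 1) 1 ≠ 0))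
    (hpin : ∀ m : ℝ → ℝ, ∀ W₁ : Set (ℝ × EuclideanSpace ℝ (Fin 3)), W₁ ⊆ W → IsOpen W₁ → W₁.Nonempty →
      ∃ z ∈ W₁, ∃ b : Fin 3, b ≠ 2 ∧
        fderiv ℝ (v z.1) z.2 (EuclideanSpace.single 2 1) b ≠
          m z.1 * fderiv ℝ (v z.1) z.2 (EuclideanSpace.single b 1) 2)
    (htw : ∀ z ∈ W,
      fderiv ℝ (fun x => fderiv ℝ (v z.1) x (EuclideanSpace.single 2 1) 2) z.2 (EuclideanSpace.single 0 1) *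
          fderiv ℝ (v z.1) z.2 (EuclideanSpace.single 1 1) 2 -
        fderiv ℝ (fun x => fderiv ℝ (v z.1) x (EuclideanSpace.single 2 1) 2) z.2 (EuclideanSpace.single 1 1) *
          fderiv ℝ (v z.1) z.2 (EuclideanSpace.single 0 1) 2 ≠ 0)
    (hTH : ∃ m : ℝ → ℝ → ℝ, ∀ z ∈ W, ∀ b : Fin 3, b ≠ 2 →
      fderiv ℝ (v z.1) z.2 (EuclideanSpace.single 2 1) b =
        m z.1 (z.2 2) * fderiv ℝ (v z.1) z.2 (EuclideanSpace.single b 1) 2) :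
    ¬ Literature.Analysis.FluidPDE.IsBackwardSingularPoint v 0 := by
  classical
  obtain ⟨m, hm⟩ := hTH
  -- the type scalar and the twist bracket as curried space–time functions
  set I : ℝ → EuclideanSpace ℝ (Fin 3) → ℝ := fun s y =>
    fderiv ℝ (v s) y (EuclideanSpace.single 2 1) 0 * fderiv ℝ (v s) y (EuclideanSpace.single 0 1) 2 +
      fderiv ℝ (v s) y (EuclideanSpace.single 2 1) 1 * fderiv ℝ (v s) y (EuclideanSpace.single 1 1) 2 with hI
  set T : ℝ → EuclideanSpace ℝ (Fin 3) → ℝ := fun s y =>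
    fderiv ℝ (fun x => fderiv ℝ (v s) x (EuclideanSpace.single 2 1) 2) y (EuclideanSpace.single 0 1) *
        fderiv ℝ (v s) y (EuclideanSpace.single 1 1) 2 -
      fderiv ℝ (fun x => fderiv ℝ (v s) x (EuclideanSpace.single 2 1) 2) y (EuclideanSpace.single 1 1) *
        fderiv ℝ (v s) y (EuclideanSpace.single 0 1) 2 with hT
  -- a product box around a point of `W`, inside `W` and inside the backward slab
  obtain ⟨z₀, hz₀⟩ := hWne
  have hs₀ : z₀.1 < 0 := (Set.mem_prod.1 (hWs hz₀)).1
  obtain ⟨ε, hε, hballW⟩ := Metric.isOpen_iff.1 hW z₀ hz₀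
  obtain ⟨r, hr0, hrε, hrs⟩ : ∃ r : ℝ, 0 < r ∧ r ≤ ε ∧ r ≤ -z₀.1 :=
    ⟨min ε (-z₀.1), lt_min hε (by linarith), min_le_left _ _, min_le_right _ _⟩
  have hbox : Set.Ioo (z₀.1 - r) (z₀.1 + r) ×ˢ Metric.ball z₀.2 r ⊆ W := by
    intro z hz
    apply hballW
    have h1 : z ∈ Metric.ball z₀.1 r ×ˢ Metric.ball z₀.2 r := by
      rw [Real.ball_eq_Ioo]; exact hz
    rw [ball_prod_same] at h1
    exact Metric.ball_subset_ball hrε h1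
  have hJneg : ∀ s ∈ Set.Ioo (z₀.1 - r) (z₀.1 + r), s < 0 := fun s hs => by linarith [hs.2]
  -- THEOREM A (class form): the slice through `z₀` carries a hyperbolic point
  set s : ℝ := z₀.1 with hsdef
  have hsJ : s ∈ Set.Ioo (z₀.1 - r) (z₀.1 + r) := ⟨by linarith, by linarith⟩
  have hs : s < 0 := hs₀
  obtain ⟨-, hnd1, hnd2⟩ := hnd z₀ hz₀
  obtain ⟨y, hy⟩ := exists_hyperbolic_point_of_TH hrate hcont hmild hdiv hW ⟨z₀, hz₀⟩ hWs hm hz₀ hnd1 hnd2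
  have hy' : I s y < 0 := hy
  have hT₀ : T s z₀.2 ≠ 0 := htw _ hz₀
  -- a point of the slice `s` where the type scalar is negative AND the twist is non-zero
  obtain ⟨y₂, hIy₂, hTy₂⟩ : ∃ y₂ : EuclideanSpace ℝ (Fin 3), I s y₂ < 0 ∧ T s y₂ ≠ 0 := by
    by_contra hcon
    push Not at hcon
    have hUo : IsOpen {y' : EuclideanSpace ℝ (Fin 3) | I s y' < 0} := by
      have hc : Continuous (I s) := by
        rw [hI]
        exact (typeScalar_analyticOnNhd_slice hrate hcont hmild hs).continuous
      exact isOpen_lt hc continuous_const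
    have hTan : AnalyticOnNhd ℝ (T s) univ := by
      rw [hT]
      exact twist_analyticOnNhd_slice hrate hcont hmild hs
    have hev : T s =ᶠ[𝓝 y] 0 := by
      filter_upwards [hUo.mem_nhds hy'] with y' hy''
      exact hcon y' hy''
    have hzero := hTan.eqOn_zero_of_preconnected_of_eventuallyEq_zero isPreconnected_univ (Set.mem_univ y) hev
    exact hT₀ (hzero (Set.mem_univ z₀.2))
  -- the relocated window
  have hslab : IsOpen (Set.Iio (0 : ℝ) ×ˢ (Set.univ : Set (EuclideanSpace ℝ (Fin 3)))) :=
    isOpen_Iio.prod isOpen_univ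
  have hAo : IsOpen ((Set.Iio (0 : ℝ) ×ˢ Set.univ) ∩
      (fun z : ℝ × EuclideanSpace ℝ (Fin 3) => I z.1 z.2) ⁻¹' Set.Iio 0) := by
    have hc : ContinuousOn (fun z : ℝ × EuclideanSpace ℝ (Fin 3) => I z.1 z.2) (Set.Iio (0 : ℝ) ×ˢ Set.univ) := by
      rw [hI]
      exact continuousOn_typeScalar hrate hcont hmild
    exact hc.isOpen_inter_preimage hslab isOpen_Iio
  have hBo : IsOpen ((Set.Iio (0 : ℝ) ×ˢ Set.univ) ∩
      (fun z : ℝ × EuclideanSpace ℝ (Fin 3) => T z.1 z.2) ⁻¹' {0}ᶜ) := by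
    have hc : ContinuousOn (fun z : ℝ × EuclideanSpace ℝ (Fin 3) => T z.1 z.2) (Set.Iio (0 : ℝ) ×ˢ Set.univ) := by
      rw [hT]
      exact continuousOn_twist hrate hcont hmild
    exact hc.isOpen_inter_preimage hslab isOpen_compl_singleton
  set W' : Set (ℝ × EuclideanSpace ℝ (Fin 3)) :=
    (Set.Ioo (z₀.1 - r) (z₀.1 + r) ×ˢ Set.univ) ∩
      (((Set.Iio (0 : ℝ) ×ˢ Set.univ) ∩ (fun z : ℝ × EuclideanSpace ℝ (Fin 3) => I z.1 z.2) ⁻¹' Set.Iio 0) ∩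
       ((Set.Iio (0 : ℝ) ×ˢ Set.univ) ∩ (fun z : ℝ × EuclideanSpace ℝ (Fin 3) => T z.1 z.2) ⁻¹' {0}ᶜ)) with hW'
  have hW'o : IsOpen W' := (isOpen_Ioo.prod isOpen_univ).inter (hAo.inter hBo)
  have hW'ne : W'.Nonempty :=
    ⟨(s, y₂), Set.mk_mem_prod hsJ (Set.mem_univ _),
      ⟨Set.mk_mem_prod hs (Set.mem_univ _), hIy₂⟩, ⟨Set.mk_mem_prod hs (Set.mem_univ _), hTy₂⟩⟩
  have hW's : W' ⊆ Set.Iio (0 : ℝ) ×ˢ Set.univ := fun z hz => hz.2.1.1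
  have hW'J : ∀ z ∈ W', z.1 ∈ Set.Ioo (z₀.1 - r) (z₀.1 + r) := fun z hz => (Set.mem_prod.1 hz.1).1
  have hW'I : ∀ z ∈ W', I z.1 z.2 < 0 := fun z hz => hz.2.1.2
  have hW'T : ∀ z ∈ W', T z.1 z.2 ≠ 0 := fun z hz => hz.2.2.2
  have hW'nd : ∀ z ∈ W', Literature.Analysis.FluidPDE.curl (v z.1) z.2 ≠ 0 ∧
      (fderiv ℝ (v z.1) z.2 (EuclideanSpace.single 0 1) 2 ≠ 0 ∨ fderiv ℝ (v z.1) z.2 (EuclideanSpace.single 1 1) 2 ≠ 0) ∧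
      (fderiv ℝ (v z.1) z.2 (EuclideanSpace.single 2 1) 0 ≠ 0 ∨ fderiv ℝ (v z.1) z.2 (EuclideanSpace.single 2 1) 1 ≠ 0) :=
    fun z hz => nd_of_typeScalar_neg (v z.1) z.2 (hW'I z hz)
  -- the pin transfers to the relocated window (identity theorem on each slice)
  have hW'pin : ∀ m : ℝ → ℝ, ∀ W₁ : Set (ℝ × EuclideanSpace ℝ (Fin 3)), W₁ ⊆ W' → IsOpen W₁ → W₁.Nonempty →
      ∃ z ∈ W₁, ∃ b : Fin 3, b ≠ 2 ∧
        fderiv ℝ (v z.1) z.2 (EuclideanSpace.single 2 1) b ≠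
          m z.1 * fderiv ℝ (v z.1) z.2 (EuclideanSpace.single b 1) 2 := by
    intro m W₁ hW₁ hW₁o hW₁ne
    by_contra hcon
    push Not at hcon
    obtain ⟨z₁, hz₁⟩ := hW₁ne
    obtain ⟨ρ, hρ, hballρ⟩ := Metric.isOpen_iff.1 hW₁o z₁ hz₁
    have hz₁J : z₁.1 ∈ Set.Ioo (z₀.1 - r) (z₀.1 + r) := hW'J z₁ (hW₁ hz₁)
    set W₂ : Set (ℝ × EuclideanSpace ℝ (Fin 3)) :=
      (Metric.ball z₁.1 ρ ∩ Set.Ioo (z₀.1 - r) (z₀.1 + r)) ×ˢ Metric.ball z₀.2 r with hW₂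
    have hW₂W : W₂ ⊆ W := fun z hz =>
      hbox (Set.mem_prod.2 ⟨(Set.mem_prod.1 hz).1.2, (Set.mem_prod.1 hz).2⟩)
    have hW₂o : IsOpen W₂ := (Metric.isOpen_ball.inter isOpen_Ioo).prod Metric.isOpen_ball
    have hW₂ne : W₂.Nonempty :=
      ⟨(z₁.1, z₀.2), Set.mk_mem_prod ⟨Metric.mem_ball_self hρ, hz₁J⟩ (Metric.mem_ball_self hr0)⟩
    obtain ⟨z, hzW₂, b, hb, hne⟩ := hpin m W₂ hW₂W hW₂o hW₂ne
    have hzt : z.1 ∈ Metric.ball z₁.1 ρ := (Set.mem_prod.1 hzW₂).1.1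
    have hzneg : z.1 < 0 := hJneg _ (Set.mem_prod.1 hzW₂).1.2
    have hrel : ∀ y' ∈ Metric.ball z₁.2 ρ,
        fderiv ℝ (v z.1) y' (EuclideanSpace.single 2 1) b = m z.1 * fderiv ℝ (v z.1) y' (EuclideanSpace.single b 1) 2 := by
      intro y' hy''
      have hmem' : (z.1, y') ∈ Metric.ball z₁.1 ρ ×ˢ Metric.ball z₁.2 ρ := Set.mk_mem_prod hzt hy''
      rw [ball_prod_same] at hmem'
      exact hcon _ (hballρ hmem') b hb
    have han := shearDefect_analyticOnNhd_slice hrate hcont hmild (m z.1) b hzneg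
    have hev : (fun y' => fderiv ℝ (v z.1) y' (EuclideanSpace.single 2 1) b -
        m z.1 * fderiv ℝ (v z.1) y' (EuclideanSpace.single b 1) 2) =ᶠ[𝓝 z₁.2] 0 := by
      filter_upwards [Metric.isOpen_ball.mem_nhds (Metric.mem_ball_self hρ)] with y' hy''
      show _ - _ = (0 : ℝ)
      rw [hrel y' hy'', sub_self]
    have hzero := han.eqOn_zero_of_preconnected_of_eventuallyEq_zero isPreconnected_univ (Set.mem_univ z₁.2) hev
    have h0 : fderiv ℝ (v z.1) z.2 (EuclideanSpace.single 2 1) b -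
        m z.1 * fderiv ℝ (v z.1) z.2 (EuclideanSpace.single b 1) 2 = 0 := hzero (Set.mem_univ z.2)
    exact hne (sub_eq_zero.1 h0)
  -- (TH) is global: the relocated window is (TH) with the global slope function
  have hNF := timeHeightShear_normalForm hrate hcont hmild hW ⟨z₀, hz₀⟩ hWs hm
  set m' : ℝ → ℝ → ℝ := fun t c =>
    if h : ∃ μ : ℝ, ∀ y : EuclideanSpace ℝ (Fin 3), y 2 = c → ∀ b : Fin 3, b ≠ 2 →
        fderiv ℝ (v t) y (EuclideanSpace.single 2 1) b = μ * fderiv ℝ (v t) y (EuclideanSpace.single b 1) 2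
    then Classical.choose h else 0 with hm'
  have hW'TH : ∃ m'' : ℝ → ℝ → ℝ, ∀ z ∈ W', ∀ b : Fin 3, b ≠ 2 →
      fderiv ℝ (v z.1) z.2 (EuclideanSpace.single 2 1) b =
        m'' z.1 (z.2 2) * fderiv ℝ (v z.1) z.2 (EuclideanSpace.single b 1) 2 := by
    refine ⟨m', fun z hz b hb => ?_⟩
    have hzneg : z.1 < 0 := (Set.mem_prod.1 (hW's hz)).1
    have hex : ∃ μ : ℝ, ∀ y : EuclideanSpace ℝ (Fin 3), y 2 = z.2 2 → ∀ b : Fin 3, b ≠ 2 →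
        fderiv ℝ (v z.1) y (EuclideanSpace.single 2 1) b = μ * fderiv ℝ (v z.1) y (EuclideanSpace.single b 1) 2 := by
      rcases hNF z.1 hzneg (z.2 2) with hflat | hμ
      · exfalso
        rcases (hW'nd z hz).2.1 with h | h
        · exact h (hflat z.2 rfl).1
        · exact h (hflat z.2 rfl).2
      · exact hμ
    have hm'z : m' z.1 (z.2 2) = Classical.choose hex := by
      simp only [hm', dif_pos hex]
    rw [hm'z]
    exact Classical.choose_spec hex z.2 rfl b hb
  exact hH W' hW'o hW'ne hW's hW'nd hW'pin hW'T hW'I hW'TH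

end Summit.NavierStokesRegularity.NavierStokesRegularity.Theorems.PoloidalWindowDoorPoloidalWindowRigidityThmARelocation

end
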